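import Summits.AnomalousDissipation.AnomalousDissipation.Theorems.DenseLoudDesignerForces.Negative.KillShape
import Summits.AnomalousDissipation.AnomalousDissipation.Theorems.DenseLoudDesignerForces.Negative.PowerBudget
import Literature.Analysis.FluidPDE.LinearizedNSTorus
import Literature.Analysis.FluidPDE.LongTimeAveragePeriodic

/-!
# Vocabulary and glue of the line `homoclinic-excursion-trains`
# for the crux `BaireTransfer.DenseLoudDesignerForces` (stmt-AnomalousDissipation-1143)

Definitions-only support file plus SORRY-FREE glue, so that the line's REGISTERED STUBS — landed one by one as
`--supports stmt-AnomalousDissipation-1143` files under `Theorems/` — and the lead's skeleton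
(`Cruxes/DenseLoudDesignerForces/Lines/homoclinic-excursion-trains.lean`, not importable) speak about the SAME
declarations.  The crux's own objects are the landed `Negative.force` (the steady trigonometric-polynomial designer
force `f_c`) and `Negative.loudSet` (`LOUD_j(S,E,ε)`) of `Theorems/DenseLoudDesignerForces/Negative/KillShape.lean`
(`Negative.denseLoudDesignerForces_iff` is `Iff.rfl`).  This file adds the vocabulary of the line (crux-plan round 2,
gen 2, planner `planner-cruxplan-stmt-AnomalousDissipation-1143-homoclinic-excursion-g2-0`; idea card
`Cruxes/DenseLoudDesignerForces/Ideas/homoclinic-excursion-trains.md`, line card `Lines/homoclinic-excursion-trains.md`):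

* `LinNSAround`, `LinNSAroundC`, `flowDir` — the (real / complexified) linearised Navier–Stokes equation around a
  space–time field, in the mean-zero slice, and the flow direction `∂ₜu`;
* `IsHyperbolicOrbit ν u τ` — hyperbolicity of a `τ`-periodic classical orbit in equation-level Floquet–Bloch form
  (no unimodular multiplier except the algebraically simple `1`);
* `h1DistSq`, `IsHomoclinicTo`, `IsTransverse` (Palmer's dichotomy form), `IsHomoclinicLoop` — a hyperbolic,
  genuinely time-periodic base orbit `P` plus a transverse homoclinic excursion `Γ` of the steadily forced NS_ν;
* `IsTrain`, `dwellSet`, `trainDwell` — one-loop shadowing trains of the excursion and their CLOSING TIME (junk `0`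
  on an empty dwell set: no existence claim);
* `loopSet S εₓ Ē j` — `LOOP_j`: forces carrying, at SOME `ν < 1/(j+1)`, such a loop with a loud excursion window of
  bounded window-mean energy, level-dependent fatness/gradient bounds, an affordable accuracy and the fatness-weighted
  closing clause `(1 + P̄)·trainDwell ≤ ℓ`;

and the glue: `dwellSet_bddBelow`, `fatness_nonneg`, `exists_short_train_of` (closing clause + ENGINE ⇒ an actual
short train), `loopSet_subset_loudSet_of` (`LOOP_j ⊆ LOUD_j(2Ē+6, εₓ/6)` GIVEN engine + budget), Entry 2
(`mem_loopSet_of_loudHyperbolicOrbit`: a loud hyperbolic periodic orbit is the degenerate loop — the sibling line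
`ergodic-budget-selection-closing`'s output lands in `LOOP_j` through it), the registered sub-goal
`homoclinic_line_glue` (ENGINE → BUDGET → PHYSICS → crux, by name) and the CONDITIONAL composition
`DenseLoudDesignerForces_of` whose three hypotheses are exactly the three registered stubs `stub_oneLoopTrains`
(ENGINE: Smale–Birkhoff / shadowing-with-uniqueness for the NS_ν semiflow near the loop), `stub_trainBudget` (BUDGET:
duty-weighted two-sided period-mean bookkeeping) and `stub_denseLoudLoops` (PHYSICS = the sharpened Transfer H_ex′)
of the skeleton, and whose conclusion is the crux BY NAME.  No facts are asserted here.

References: Hale–Lin, *Symbolic dynamics and nonlinear semiflows*, Ann. Mat. Pura Appl. 144 (1986), Thm. 5.2, §8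
(Def. 8.1–8.2, Thm. 8.3); Palmer, J. Diff. Eq. 55 (1984), Prop. 2.2, Lemma 4.2; Steinlein–Walther, J. Dynam. Diff. Eq. 2
(1990); Chow–Lin–Palmer (1989) as stated in Pilyugin, *Shadowing in dynamical systems*, LNM 1706 (1999), §1.3.4;
van Veen–Kawahara, PRL 107 (2011) 114501 (homoclinic tangle in shear flow); the route file `Theses/BaireTransfer.lean`
(item 1143).
-/

-- `Summit.<Summit>.<Problem>` is the tree's mandated summit-side namespace (CONVENTIONS §2); for this
-- single-conjunct summit the two coincide, so the duplicate is deliberate.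
set_option linter.dupNamespace false

noncomputable section

open scoped BigOperators Topology
open Filter Set Function TopologicalSpace MeasureTheory

namespace Summit.AnomalousDissipation.AnomalousDissipation.Theorems.DenseLoudDesignerForces.Homoclinic

open Literature.Analysis.FunctionSpaces Literature.Analysis.FunctionSpaces.Torus
open Literature.Analysis.FluidPDE
open Summit.AnomalousDissipation.AnomalousDissipation.Theses.BaireTransfer
open Summit.AnomalousDissipation.AnomalousDissipation.Theorems.DenseLoudDesignerForces.Negative

/-- The flat unit torus `T³`. -/
local notation "𝕋³" => UnitAddTorus (Fin 3)
/-- Real velocity values. -/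
local notation "ℝ³" => EuclideanSpace ℝ (Fin 3)
/-- Complex Fourier coefficients / complexified velocities. -/
local notation "ℂ³" => EuclideanSpace ℂ (Fin 3)

/-! ## §0 The crux's vocabulary (the landed `Negative.force`, `Negative.loudSet`) -/

/-- **The crux, restated** through the landed vocabulary (definitional, as `Negative.denseLoudDesignerForces_iff`
with `IsWindow` unfolded). [folklore] -/
theorem crux_iff :
    DenseLoudDesignerForces ↔
      ∀ S₀ : Finset (Fin 3 → ℤ), ∃ S : Finset (Fin 3 → ℤ), S₀ ⊆ S ∧ ∃ (E ε : ℝ), 0 < ε ∧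
        ∃ U : Set (↥S → ℂ³), IsOpen U ∧ U.Nonempty ∧ ∀ j : ℕ, U ⊆ closure (loudSet S E ε j) :=
  Iff.rfl

/-! ## §1 The linearised Navier–Stokes equation around a space–time field -/

/-- **The linearised Navier–Stokes equation around the space–time field `u`** (real form, inhomogeneity `g`):
`z, q` jointly smooth on `ℝ × T³`, `z(t)` divergence free and MEAN ZERO (in-slice linearisation: `f_c` is mean
zero, the velocity mean is conserved, and every dynamical notion below lives in the affine slice `{∫u = ∫u_P}` —
the three Galilean/momentum directions are thereby removed, cf. triage X2/F1 of the sibling crux), and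
`∂ₜz + (u·∇)z + (z·∇)u = νΔz − ∇q + g` pointwise (the classical variational equation of NS; Henry 1981, ConstantinFoias1988
Ch. 7 for the steady case = the tree's `Torus.linearizedNSOperator`). [folklore] -/
def LinNSAround (ν : ℝ) (u z : ℝ → 𝕋³ → ℝ³) (q : ℝ → 𝕋³ → ℝ) (g : ℝ → 𝕋³ → ℝ³) : Prop :=
  IsSmoothSpaceTimeOn Set.univ z ∧ IsSmoothSpaceTimeOn Set.univ q ∧
    (∀ t, IsDivFree (z t)) ∧ (∀ t, HasZeroMean (z t)) ∧
    ∀ t x, Torus.timeDerivWithin Set.univ z t x + convect (u t) (z t) x + convect (z t) (u t) x =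
      ν • laplacian (z t) x - Torus.gradient (q t) x + g t x

/-- The complexified homogeneous linearised equation around `u` (for Floquet–Bloch solutions with unimodular
multipliers `ρ ≠ 1`): `∂ₜz + DB(u(t)) z = νΔz − ∇q` with the tree's `Torus.linConvect (u t) (z t) = (u·∇)z + (z·∇)u`,
`z(t)` complex, divergence free, mean zero. [folklore] -/
def LinNSAroundC (ν : ℝ) (u : ℝ → 𝕋³ → ℝ³) (z : ℝ → 𝕋³ → ℂ³) (q : ℝ → 𝕋³ → ℂ) : Prop :=
  IsSmoothSpaceTimeOn Set.univ z ∧ IsSmoothSpaceTimeOn Set.univ q ∧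
    (∀ t, Torus.IsDivFreeC (z t)) ∧ (∀ t, HasZeroMean (z t)) ∧
    ∀ t x, Torus.timeDerivWithin Set.univ z t x + Torus.linConvect (u t) (z t) x =
      ν • laplacian (z t) x - Torus.gradientC (q t) x

/-- The flow direction `∂ₜu` (a solution of the homogeneous linearised equation around every classical solution
of the steadily forced system). [folklore] -/
def flowDir (u : ℝ → 𝕋³ → ℝ³) : ℝ → 𝕋³ → ℝ³ :=
  fun t x => Torus.timeDerivWithin Set.univ u t x

/-! ## §2 Hyperbolic periodic orbits (equation-level Floquet form) -/

/-- **Hyperbolicity of a `τ`-periodic classical solution `u` of NS_ν (in its mean slice)**, stated WITHOUT a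
period map, through Floquet–Bloch solutions of the linearised equation: (a) for every UNIMODULAR multiplier
`ρ ≠ 1` the complex linearised equation has no non-zero Bloch solution `z(t+τ) = ρ z(t)`; (b) the multiplier `1`
is algebraically simple with eigenvector the flow direction — every smooth mean-zero `τ`-periodic solution `z` of
`∂ₜz + (u·∇)z + (z·∇)u = νΔz − ∇q + κ∂ₜu` has `κ∂ₜu ≡ 0` and `z ∈ ℝ∂ₜu` (no second eigenvector, no Jordan
partner).  At `ν > 0` the in-slice period map `U(τ)` is compact, its Floquet multipliers are eigenvalues, and Bloch
solutions on `ℝ` are exactly eigenvectors (continue `U(t)v` backwards along `ρ^{-k}`), so (a)+(b) say: the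
Poincaré return map at `u(0)` has a HYPERBOLIC fixed point (HaleLin1986 Def. 8.1: `σ(DF(ξ(0))) ∩ {|λ| = 1} = ∅` for the
return map `F`, independent of the section, Thm. 8.3). [cite: HaleLin1986, Def. 8.1] -/
def IsHyperbolicOrbit (ν : ℝ) (u : ℝ → 𝕋³ → ℝ³) (τ : ℝ) : Prop :=
  (∀ (z : ℝ → 𝕋³ → ℂ³) (q : ℝ → 𝕋³ → ℂ) (ρ : ℂ), ‖ρ‖ = 1 → ρ ≠ 1 →
      LinNSAroundC ν u z q → (∀ t x, z (t + τ) x = ρ • z t x) → ∀ t x, z t x = 0) ∧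
  (∀ (z : ℝ → 𝕋³ → ℝ³) (q : ℝ → 𝕋³ → ℝ) (κ : ℝ),
      LinNSAround ν u z q (fun t x => κ • flowDir u t x) → Function.Periodic z τ →
        (∀ t x, κ • flowDir u t x = 0) ∧ ∃ l : ℝ, ∀ t x, z t x = l • flowDir u t x)

/-! ## §3 Homoclinic excursions and their transversality (equation level) -/

/-- Squared `H¹` distance of two velocity fields: `∫‖v − w‖² + ‖∇(v − w)‖₂²` (pointwise gradients,
`Torus.gradNormSq`; meaningful for `C¹` fields, which is how it is used). [folklore] -/
def h1DistSq (v w : 𝕋³ → ℝ³) : ℝ :=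
  (∫ x, ‖v x - w x‖ ^ 2) + gradNormSq (fun x => v x - w x)

/-- **`u_Γ` is homoclinic to the periodic orbit of `u_P`**: it is `H¹`-asymptotic, as `t → +∞` and as
`t → −∞`, to two time-shifted copies of `u_P` (the asymptotic phases `θ₊`, `θ₋` exist at a hyperbolic periodic
orbit; HaleLin1986 Def. 8.2, Palmer1984 Prop. 2.2).  The trivial case `u_Γ = u_P` is allowed (then the excursion is the base
itself). [cite: HaleLin1986, Def. 8.2] -/
def IsHomoclinicTo (uP uΓ : ℝ → 𝕋³ → ℝ³) : Prop :=
  ∃ θp θm : ℝ, Tendsto (fun t => h1DistSq (uΓ t) (uP (t + θp))) atTop (𝓝 0) ∧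
    Tendsto (fun t => h1DistSq (uΓ t) (uP (t + θm))) atBot (𝓝 0)

/-- **Transversality of the homoclinic orbit `u_Γ`, in PALMER'S DICHOTOMY FORM** (no invariant manifolds
needed): every smooth mean-zero solution `z` of the homogeneous linearised equation around `u_Γ` that is defined on
all of `ℝ` and `H¹`-BOUNDED is a real multiple of the flow direction `∂ₜu_Γ`.  (Bounded-backward solutions span
`T W^{cu}(P)`, bounded-forward ones `T W^{cs}(P)`; with `P` hyperbolic and `W^u(P)` finite dimensional,
`dim(T W^u ∩ T W^s) = 1` iff `W^u(P) ⋔ W^s(P)` along `Γ` — Palmer1984 Prop. 2.2 (ii): transversal homoclinic point iff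
convergence + exponential dichotomy of the variational equation on `(-∞, ∞)`, Lemma 4.2: then the bounded solutions are the
span of the flow direction; Lin1986 for semiflows of functional differential equations; HaleLin1986 Def. 8.2 for the
geometric form at a periodic trajectory.) [cite: Palmer1984, Prop. 2.2 (ii) and Lemma 4.2] -/
def IsTransverse (ν : ℝ) (uΓ : ℝ → 𝕋³ → ℝ³) : Prop :=
  ∀ (z : ℝ → 𝕋³ → ℝ³) (q : ℝ → 𝕋³ → ℝ), LinNSAround ν uΓ z q (fun _ _ => 0) →
    (∃ M : ℝ, ∀ t, (∫ x, ‖z t x‖ ^ 2) + gradNormSq (z t) ≤ M) →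
      ∃ l : ℝ, ∀ t x, z t x = l • flowDir uΓ t x

/-- **A hyperbolic–transverse homoclinic LOOP of NS_ν with steady force `F`**: a GENUINELY time-periodic (not steady:
`∂ₜu_P ≢ 0`) `τ_P`-periodic classical solution `u_P` on `ℝ × T³` (the BASE — any budget: calm, loud or fat),
hyperbolic in its mean slice, and a classical solution `u_Γ` on `ℝ × T³` (the EXCURSION) homoclinic to it and
transverse.  Non-steadiness is load-bearing (the card's caveat (1a), triage r2-1): for a periodic base
`dim W^u(P) + codim W^s(P)` exceed the ambient dimension by one, so a transverse `Γ` is codimension ZERO and carries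
a Smale–Birkhoff horseshoe, whereas a nondegenerate homoclinic orbit of a hyperbolic STEADY state is codimension one
(Shilnikov) and in the tame-saddle case has no periodic orbits nearby — there `IsTransverse` would still hold
(`∂ₜu_Γ` spans the bounded solutions) but Stub 1 would be false.  Two finite objects of the fixed-`ν` dynamics, both
within reach of validated numerics at moderate `ν` (radii-polynomial periodic orbits BergBredenLessardVeen2021;
connecting orbits); at small `ν` they are the physics stub's hypothesis.  Pressures are existentially quantified so
that the closing time below depends on velocities only. [cite: HaleLin1986, Def. 8.1–8.2] -/
structure IsHomoclinicLoop (ν : ℝ) (F : 𝕋³ → ℝ³) (uP : ℝ → 𝕋³ → ℝ³) (τP : ℝ)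
    (uΓ : ℝ → 𝕋³ → ℝ³) : Prop where
  /-- the base period is positive -/
  period_pos : 0 < τP
  /-- the base is a global classical solution of NS_ν(F) -/
  base : ∃ pP : ℝ → 𝕋³ → ℝ, IsClassicalNSSolutionOn Set.univ ν (fun _ => F) uP pP
  /-- the base is `τ_P`-periodic … -/
  periodic : Function.Periodic uP τP
  /-- … and genuinely time dependent (not a steady state) -/
  nonsteady : ∃ (t : ℝ) (x : 𝕋³), flowDir uP t x ≠ 0
  /-- the base is hyperbolic in its mean slice -/
  hyperbolic : IsHyperbolicOrbit ν uP τP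
  /-- the excursion is a global (eternal) classical solution of NS_ν(F) -/
  excursion : ∃ pΓ : ℝ → 𝕋³ → ℝ, IsClassicalNSSolutionOn Set.univ ν (fun _ => F) uΓ pΓ
  /-- the excursion is homoclinic to the base -/
  homoclinic : IsHomoclinicTo uP uΓ
  /-- and transverse (Palmer form) -/
  transverse : IsTransverse ν uΓ

/-! ## §4 One-loop trains and the closing time of an excursion -/

/-- **A ONE-LOOP TRAIN of the excursion `u_Γ` (cut length `ℓ`, accuracy `δ`, dwell `d`)**: a periodic classical
solution `u` of the SAME system NS_ν(F) on `ℝ × T³`, period `ℓ + d`, which is `δ`-close to `u_Γ(t)` in `H¹` for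
every `t` in ONE FULL PERIOD `[-d/2, ℓ + d/2]` — it follows the excursion window `[0, ℓ]` and the two adjacent
tails of `Γ` (which run to and from the base), closing up inside the tails.  These are the simplest periodic points
of the Smale–Birkhoff horseshoe of `P ∪ Γ` (itinerary "one excursion, then `m` turns near `P`"; HaleLin1986 Thm. 5.2,
SteinleinWalther1990). [folklore] -/
def IsTrain (ν : ℝ) (F : 𝕋³ → ℝ³) (uΓ : ℝ → 𝕋³ → ℝ³) (ℓ δ d : ℝ) (u : ℝ → 𝕋³ → ℝ³)
    (p : ℝ → 𝕋³ → ℝ) : Prop :=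
  IsClassicalNSSolutionOn Set.univ ν (fun _ => F) u p ∧ Function.Periodic u (ℓ + d) ∧
    ∀ t ∈ Set.Icc (-(d / 2)) (ℓ + d / 2), h1DistSq (u t) (uΓ t) ≤ δ ^ 2

/-- The DWELL SET of the excursion at cut length `ℓ` and accuracy `δ`: the dwells `d ≥ 0` of its one-loop trains.
[folklore] -/
def dwellSet (ν : ℝ) (F : 𝕋³ → ℝ³) (uΓ : ℝ → 𝕋³ → ℝ³) (ℓ δ : ℝ) : Set ℝ :=
  {d | 0 ≤ d ∧ ∃ (u : ℝ → 𝕋³ → ℝ³) (p : ℝ → 𝕋³ → ℝ), IsTrain ν F uΓ ℓ δ d u p}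

/-- **The one-loop CLOSING TIME `trainDwell ν F u_Γ ℓ δ`**: the infimum of the dwells of `δ`-accurate one-loop
trains of the excursion.  JUNK VALUE `0` when no train exists (`Real.sInf_empty`) — deliberately: this number carries
NO existence claim, existence of trains being exactly the content of the engine stub `stub_oneLoopTrains`; the
physics stub only compares it with the excursion length.  Shadowing theory predicts
`trainDwell ≍ λ⁻¹·log(L/δ)` (`λ` = Floquet gap of the base, `L` = dichotomy constant of `Γ`). [folklore] -/
def trainDwell (ν : ℝ) (F : 𝕋³ → ℝ³) (uΓ : ℝ → 𝕋³ → ℝ³) (ℓ δ : ℝ) : ℝ :=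
  sInf (dwellSet ν F uΓ ℓ δ)

/-- The dwell set is bounded below by `0`. [folklore] -/
theorem dwellSet_bddBelow (ν : ℝ) (F : 𝕋³ → ℝ³) (uΓ : ℝ → 𝕋³ → ℝ³) (ℓ δ : ℝ) :
    BddBelow (dwellSet ν F uΓ ℓ δ) :=
  ⟨0, fun _ hd => hd.1⟩

/-! ## §5 The loop sets of the physics stub -/

/-- **`LOOP_j(S, εₓ, Ē)`** — coefficient vectors `c` whose force `f_c` carries, at SOME `ν ∈ (0, 1/(j+1))`, a
hyperbolic–transverse homoclinic loop `(u_P, τ_P, u_Γ)` with: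
* a LOUD EXCURSION WINDOW `[0, ℓ]`, `ℓ > 0`, `ν∫₀^ℓ ‖∇u_Γ‖² ≥ εₓℓ`, of BOUNDED WINDOW-MEAN ENERGY
  `∫₀^ℓ ‖u_Γ(t)‖₂² dt ≤ Ēℓ` — the two budgets `(εₓ, Ē)` are the only level-independent data;
* SOME loop-wide bounds, chosen PER LEVEL and never entering the budgets: the FATNESS `‖u_Γ(t)‖₂² ≤ P̄` for all
  `t` (Γ's tails converge to the base, so `P̄` also bounds the base orbit: a calm base has `P̄ ≍ Ē`, a fat base
  riding the laminar sheet has `P̄ ≍ ν⁻²` — ALLOWED, and paid for below in closing time, exactly the card's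
  duty-cycle bet) and the gradient bound `‖∇u_Γ(t)‖₂² ≤ Ḡ` for all `t` (a loud window forces `Ḡ ≥ εₓ/ν → ∞` along
  the levels; it enters only the affordability clause);
* an AFFORDABLE ACCURACY `δ` — `0 < δ ≤ 1` and `4νδ√Ḡ ≤ εₓ`, i.e. coarse: a fixed fraction of the excursion's own
  `H¹` size — at which the FATNESS-WEIGHTED one-loop closing time does not exceed the excursion length,
  `(1 + P̄) · trainDwell ν f_c u_Γ ℓ δ ≤ ℓ` ("the loud transient outlasts the time its trains need to close up
  near the base, times the base's fatness": duty `≥ 1/2` and fat-dwell energy `P̄·d/(ℓ+d) ≲ 1`; triage r2-1 (1b)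
  quantified — with `trainDwell ≍ λ⁻¹log(1/δ)` this reads `T_ex ≳ (1 + E_P)·λ⁻¹·log(1/δ)`).
The level enters through `ν < 1/(j+1)`: `(ν, P, Γ, ℓ, P̄, Ḡ, δ)` are re-chosen at every level and every force, the
budgets `(εₓ, Ē)` are not. [folklore] -/
def loopSet (S : Finset (Fin 3 → ℤ)) (εx Eb : ℝ) (j : ℕ) : Set (↥S → ℂ³) :=
  {c | ∃ ν : ℝ, 0 < ν ∧ ν < 1 / ((j : ℝ) + 1) ∧
    ∃ (uP : ℝ → 𝕋³ → ℝ³) (τP : ℝ) (uΓ : ℝ → 𝕋³ → ℝ³) (ℓ Pb Gb δ : ℝ),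
      IsHomoclinicLoop ν (force S c) uP τP uΓ ∧ 0 < ℓ ∧
      εx * ℓ ≤ ν * ∫ t in (0 : ℝ)..ℓ, gradNormSq (uΓ t) ∧
      (∫ t in (0 : ℝ)..ℓ, (∫ x, ‖uΓ t x‖ ^ 2)) ≤ Eb * ℓ ∧
      (∀ t, (∫ x, ‖uΓ t x‖ ^ 2) ≤ Pb) ∧ (∀ t, gradNormSq (uΓ t) ≤ Gb) ∧
      0 < δ ∧ δ ≤ 1 ∧ 4 * ν * δ * Real.sqrt Gb ≤ εx ∧
      (1 + Pb) * trainDwell ν (force S c) uΓ ℓ δ ≤ ℓ}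

/-! ## §6 Glue (sorry-free): from the closing clause to a short train, `LOOP_j ⊆ LOUD_j`, Entry 2 -/

/-- The fatness bound of a loop is non-negative (it bounds a squared `L²` norm). [folklore] -/
theorem fatness_nonneg {uΓ : ℝ → 𝕋³ → ℝ³} {Pb : ℝ} (hP : ∀ t, (∫ x, ‖uΓ t x‖ ^ 2) ≤ Pb) : 0 ≤ Pb :=
  (integral_nonneg fun _ => sq_nonneg _).trans (hP 0)

/-- **From closing time to an actual short train (GIVEN the engine).**  For a genuine loop at `ν > 0` the engine
(hypothesis `engine` = the registered stub `stub_oneLoopTrains` verbatim) makes the dwell set non-empty, so the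
fatness-weighted clause `(1 + P̄)·trainDwell ≤ ℓ` (with `ℓ > 0`, `P̄ ≥ 0`) produces a train with `(1 + P̄)·d < 2ℓ` — i.e. dwell `d < 2ℓ` (duty `ℓ/(ℓ+d) > 1/3`) AND fat-dwell weight `P̄·d < 2ℓ`.  This is the
ONLY place the engine stub is used — and it is indispensable there (`trainDwell` of an empty dwell set is the junk
value `0`). [folklore] -/
theorem exists_short_train_of (engine : (∀ (ν : ℝ) (F : 𝕋³ → ℝ³) (uP : ℝ → 𝕋³ → ℝ³) (τP : ℝ) (uΓ : ℝ → 𝕋³ → ℝ³), 0 < ν → IsHomoclinicLoop ν F uP τP uΓ → ∀ (ℓ : ℝ), 0 ≤ ℓ → ∀ (δ : ℝ), 0 < δ → ∃ d : ℝ, 0 ≤ d ∧ ∃ (u : ℝ → 𝕋³ → ℝ³) (p : ℝ → 𝕋³ → ℝ), IsTrain ν F uΓ ℓ δ d u p))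
    {ν : ℝ} {F : 𝕋³ → ℝ³} {uP : ℝ → 𝕋³ → ℝ³} {τP : ℝ} {uΓ : ℝ → 𝕋³ → ℝ³}
    (hν : 0 < ν) (hloop : IsHomoclinicLoop ν F uP τP uΓ) {ℓ δ Pb : ℝ} (hℓ : 0 < ℓ) (hδ : 0 < δ)
    (hPb : 0 ≤ Pb) (hdw : (1 + Pb) * trainDwell ν F uΓ ℓ δ ≤ ℓ) :
    ∃ d : ℝ, 0 ≤ d ∧ (1 + Pb) * d < 2 * ℓ ∧
      ∃ (u : ℝ → 𝕋³ → ℝ³) (p : ℝ → 𝕋³ → ℝ), IsTrain ν F uΓ ℓ δ d u p := by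
  have hne : (dwellSet ν F uΓ ℓ δ).Nonempty := by
    obtain ⟨d, hd, u, p, h⟩ := engine ν F uP τP uΓ hν hloop ℓ hℓ.le δ hδ
    exact ⟨d, hd, u, p, h⟩
  have h1 : 0 < 1 + Pb := by linarith
  have hlt : sInf (dwellSet ν F uΓ ℓ δ) < 2 * ℓ / (1 + Pb) := by
    rw [lt_div_iff₀ h1]
    calc sInf (dwellSet ν F uΓ ℓ δ) * (1 + Pb) = (1 + Pb) * trainDwell ν F uΓ ℓ δ := by
          unfold trainDwell; ring
      _ ≤ ℓ := hdw
      _ < 2 * ℓ := by linarith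
  obtain ⟨d, hd, hd2⟩ := (csInf_lt_iff (dwellSet_bddBelow ν F uΓ ℓ δ) hne).1 hlt
  refine ⟨d, hd.1, ?_, hd.2⟩
  rw [lt_div_iff₀ h1] at hd2
  linarith

/-- **`LOOP_j ⊆ LOUD_j` (GIVEN the engine and the budget stub)** with the budgets `E := 2Ē + 6`, `ε := εₓ/6`:
a short train of a loud excursion of bounded window-mean energy is a loud bounded periodic witness of the SAME force
at the SAME viscosity (hypotheses `engine`, `budget` = the registered stubs `stub_oneLoopTrains`, `stub_trainBudget`
verbatim; the affordable accuracy gives `εₓ − 2νδ√Ḡ ≥ εₓ/2`, the short dwell gives duty `> 1/3`, the fatness-weighted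
clause gives `2P̄·d/(ℓ+d) < 4`, and `δ ≤ 1` caps the accuracy slack). [folklore] -/
theorem loopSet_subset_loudSet_of (engine : (∀ (ν : ℝ) (F : 𝕋³ → ℝ³) (uP : ℝ → 𝕋³ → ℝ³) (τP : ℝ) (uΓ : ℝ → 𝕋³ → ℝ³), 0 < ν → IsHomoclinicLoop ν F uP τP uΓ → ∀ (ℓ : ℝ), 0 ≤ ℓ → ∀ (δ : ℝ), 0 < δ → ∃ d : ℝ, 0 ≤ d ∧ ∃ (u : ℝ → 𝕋³ → ℝ³) (p : ℝ → 𝕋³ → ℝ), IsTrain ν F uΓ ℓ δ d u p))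
    (budget : (∀ (ν ℓ δ d εx Eb Pb Gb : ℝ) (F : 𝕋³ → ℝ³) (uΓ u : ℝ → 𝕋³ → ℝ³) (pΓ p : ℝ → 𝕋³ → ℝ), 0 ≤ ν → 0 < ℓ → 0 ≤ d → 0 ≤ δ → IsClassicalNSSolutionOn Set.univ ν (fun _ => F) uΓ pΓ → IsTrain ν F uΓ ℓ δ d u p → εx * ℓ ≤ ν * ∫ t in (0 : ℝ)..ℓ, gradNormSq (uΓ t) → (∫ t in (0 : ℝ)..ℓ, (∫ x, ‖uΓ t x‖ ^ 2)) ≤ Eb * ℓ → (∀ t, (∫ x, ‖uΓ t x‖ ^ 2) ≤ Pb) → (∀ t, gradNormSq (uΓ t) ≤ Gb) → (εx - 2 * ν * δ * Real.sqrt Gb) * (ℓ / (ℓ + d)) ≤ meanDissipation ν u ∧ meanEnergy u ≤ 2 * Eb + 2 * δ ^ 2 + 2 * Pb * (d / (ℓ + d))))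
    (S : Finset (Fin 3 → ℤ)) {εx : ℝ} (Eb : ℝ) (hεx : 0 < εx) (j : ℕ) :
    loopSet S εx Eb j ⊆ loudSet S (2 * Eb + 6) (εx / 6) j := by
  rintro c ⟨ν, hν, hνj, uP, τP, uΓ, ℓ, Pb, Gb, δ, hloop, hℓ, hwin, hwinE, hP, hG, hδ, hδ1, hcoarse, hdw⟩
  have hPb : 0 ≤ Pb := fatness_nonneg hP
  obtain ⟨d, hd, hd2, u, p, htrain⟩ := exists_short_train_of engine hν hloop hℓ hδ hPb hdw
  obtain ⟨pΓ, hΓ⟩ := hloop.excursion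
  obtain ⟨hdiss, hen⟩ := budget ν ℓ δ d εx Eb Pb Gb (force S c) uΓ u pΓ p hν.le hℓ hd hδ.le hΓ htrain hwin hwinE hP hG
  have hτ : 0 < ℓ + d := by linarith
  have hd2' : d < 2 * ℓ := by nlinarith
  refine ⟨ν, hν, hνj, ℓ + d, u, p, hτ, htrain.1, htrain.2.1, ?_, ?_⟩
  · -- energy: `2Ē + 2δ² + 2P̄·d/(ℓ+d) ≤ 2Ē + 2 + 4`
    have hfrac : 2 * Pb * (d / (ℓ + d)) ≤ 4 := by
      rw [show 2 * Pb * (d / (ℓ + d)) = 2 * Pb * d / (ℓ + d) by ring, div_le_iff₀ hτ]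
      nlinarith
    have h2 : δ ^ 2 ≤ 1 := by nlinarith
    linarith
  · -- dissipation: `(εₓ − 2νδ√Ḡ) · ℓ/(ℓ+d) ≥ (εₓ/2) · (1/3)`
    have ha : εx / 2 ≤ εx - 2 * ν * δ * Real.sqrt Gb := by linarith
    have hb : (1 : ℝ) / 3 ≤ ℓ / (ℓ + d) := by
      rw [le_div_iff₀ hτ]
      linarith
    have hprod : εx / 2 * (1 / 3) ≤ (εx - 2 * ν * δ * Real.sqrt Gb) * (ℓ / (ℓ + d)) :=
      mul_le_mul ha hb (by norm_num) (by linarith)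
    calc εx / 6 = εx / 2 * (1 / 3) := by ring
      _ ≤ (εx - 2 * ν * δ * Real.sqrt Gb) * (ℓ / (ℓ + d)) := hprod
      _ ≤ meanDissipation ν u := hdiss

/-! ### Entry 2 (sorry-free): a loud hyperbolic periodic orbit is the degenerate loop `Γ = P`

The hypothesis class of the line CONTAINS the direct witnesses of the sibling entry points (a loud, bounded,
hyperbolic, genuinely periodic orbit: the output of the closing card `ergodic-budget-selection-closing`, the
certified-UPO entry of `RobustLoudSomewhere` stmt-1150, triage r2-2's "salvage"): with `u_Γ := u_P`, the cut
`ℓ := τ_P` and the fatness `P̄ := sup_t ‖u_P(t)‖₂²`, the orbit is its own train with dwell `0`, so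
`(1 + P̄)·trainDwell ≤ 0 ≤ ℓ` and the loud window is one period.  `LOOP_j` thus interpolates between "loud
hyperbolic UPO" (no excursion) and "calm or fat base + long loud excursion". -/

/-- `‖∇0‖₂² = 0` (pointwise gradients of the zero field vanish). [folklore] -/
theorem gradNormSq_zero_fun : gradNormSq (fun _ : 𝕋³ => (0 : ℝ³)) = 0 := by
  unfold gradNormSq
  have hpd : ∀ (i : Fin 3) (x : 𝕋³), Torus.partialDeriv i (fun _ : 𝕋³ => (0 : ℝ³)) x = 0 := fun i x => by
    change deriv (fun _ : ℝ => (0 : ℝ³)) 0 = 0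
    simp
  simp [hpd]

/-- `h1DistSq v v = 0`. [folklore] -/
theorem h1DistSq_self (v : 𝕋³ → ℝ³) : h1DistSq v v = 0 := by
  unfold h1DistSq
  simp only [sub_self, norm_zero, ne_eq, OfNat.ofNat_ne_zero, not_false_eq_true, zero_pow, integral_zero,
    zero_add]
  exact gradNormSq_zero_fun

/-- Every space–time field is (trivially) homoclinic to itself. [folklore] -/
theorem isHomoclinicTo_self (u : ℝ → 𝕋³ → ℝ³) : IsHomoclinicTo u u := by
  refine ⟨0, 0, ?_, ?_⟩ <;> simpa only [add_zero, h1DistSq_self] using tendsto_const_nhds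

/-- A `τ`-periodic classical solution is a one-loop train OF ITSELF with cut `τ` and dwell `0` (any accuracy).
[folklore] -/
theorem zero_mem_dwellSet {ν τ δ : ℝ} {F : 𝕋³ → ℝ³} {u : ℝ → 𝕋³ → ℝ³} {p : ℝ → 𝕋³ → ℝ}
    (hsol : IsClassicalNSSolutionOn Set.univ ν (fun _ => F) u p) (hper : Function.Periodic u τ) :
    (0 : ℝ) ∈ dwellSet ν F u τ δ := by
  refine ⟨le_rfl, u, p, hsol, by simpa only [add_zero] using hper, fun t _ => ?_⟩
  rw [h1DistSq_self]
  positivity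

/-- **Entry 2.** A force carrying, at `ν ∈ (0, 1/(j+1))`, a genuinely time-periodic, hyperbolic classical
solution `u` with a loud period (`εₓτ ≤ ν∫₀^τ‖∇u‖²`), period-mean energy `≤ Ē` (`∫₀^τ‖u‖₂² ≤ Ēτ`), sup bounds
`(P̄, Ḡ)` and an affordable accuracy lies in `LOOP_j` — the degenerate loop `u_Γ = u_P`, closing time `≤ 0`.
(`IsTransverse ν u` for the base itself is a CONSEQUENCE of hyperbolicity — the bounded solutions around a
hyperbolic periodic orbit are the flow direction — but not definitionally, so it is kept as a hypothesis.)
[folklore] -/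
theorem mem_loopSet_of_loudHyperbolicOrbit {S : Finset (Fin 3 → ℤ)} {εx Eb Pb Gb : ℝ} {j : ℕ} {c : ↥S → ℂ³}
    {ν τ δ : ℝ} {u : ℝ → 𝕋³ → ℝ³} {p : ℝ → 𝕋³ → ℝ}
    (hν : 0 < ν) (hνj : ν < 1 / ((j : ℝ) + 1)) (hτ : 0 < τ)
    (hsol : IsClassicalNSSolutionOn Set.univ ν (fun _ => force S c) u p) (hper : Function.Periodic u τ)
    (hns : ∃ (t : ℝ) (x : 𝕋³), flowDir u t x ≠ 0) (hhyp : IsHyperbolicOrbit ν u τ) (htr : IsTransverse ν u)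
    (hwin : εx * τ ≤ ν * ∫ t in (0 : ℝ)..τ, gradNormSq (u t))
    (hwinE : (∫ t in (0 : ℝ)..τ, (∫ x, ‖u t x‖ ^ 2)) ≤ Eb * τ)
    (hP : ∀ t, (∫ x, ‖u t x‖ ^ 2) ≤ Pb) (hG : ∀ t, gradNormSq (u t) ≤ Gb)
    (hδ : 0 < δ) (hδ1 : δ ≤ 1) (hco : 4 * ν * δ * Real.sqrt Gb ≤ εx) :
    c ∈ loopSet S εx Eb j := by
  refine ⟨ν, hν, hνj, u, τ, u, τ, Pb, Gb, δ,
    ⟨hτ, ⟨p, hsol⟩, hper, hns, hhyp, ⟨p, hsol⟩, isHomoclinicTo_self u, htr⟩,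
    hτ, hwin, hwinE, hP, hG, hδ, hδ1, hco, ?_⟩
  have h0 : trainDwell ν (force S c) u τ δ ≤ 0 :=
    csInf_le (dwellSet_bddBelow ν (force S c) u τ δ) (zero_mem_dwellSet hsol hper)
  have h1 : 0 ≤ 1 + Pb := by linarith [fatness_nonneg hP]
  calc (1 + Pb) * trainDwell ν (force S c) u τ δ ≤ (1 + Pb) * 0 := mul_le_mul_of_nonneg_left h0 h1
    _ = 0 := mul_zero _
    _ ≤ τ := hτ.le

/-! ## §7 The registered sub-goal `homoclinic_line_glue` and the conditional composition -/

/-- **Registered sub-goal `homoclinic_line_glue` (curried line glue):** ENGINE → BUDGET → PHYSICS → the crux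
`DenseLoudDesignerForces` BY NAME, the three hypotheses being the three registered stubs `stub_oneLoopTrains`,
`stub_trainBudget`, `stub_denseLoudLoops` of the skeleton verbatim (explicit-binder form).  Proof: the physics stub
gives `S ⊇ S₀`, `εₓ > 0`, `Ē` and an open non-empty `U` with `U ⊆ closure LOOP_j` at every level; take `E := 2Ē + 6`,
`ε := εₓ/6 > 0`; then `closure LOOP_j ⊆ closure LOUD_j(S,E,ε)` by `loopSet_subset_loudSet_of` and `closure_mono`.
[folklore] -/
theorem homoclinic_line_glue : (∀ (ν : ℝ) (F : 𝕋³ → ℝ³) (uP : ℝ → 𝕋³ → ℝ³) (τP : ℝ) (uΓ : ℝ → 𝕋³ → ℝ³), 0 < ν → IsHomoclinicLoop ν F uP τP uΓ → ∀ (ℓ : ℝ), 0 ≤ ℓ → ∀ (δ : ℝ), 0 < δ → ∃ d : ℝ, 0 ≤ d ∧ ∃ (u : ℝ → 𝕋³ → ℝ³) (p : ℝ → 𝕋³ → ℝ), IsTrain ν F uΓ ℓ δ d u p) → (∀ (ν ℓ δ d εx Eb Pb Gb : ℝ) (F : 𝕋³ → ℝ³) (uΓ u : ℝ → 𝕋³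 → ℝ³) (pΓ p : ℝ → 𝕋³ → ℝ), 0 ≤ ν → 0 < ℓ → 0 ≤ d → 0 ≤ δ → IsClassicalNSSolutionOn Set.univ ν (fun _ => F) uΓ pΓ → IsTrain ν F uΓ ℓ δ d u p → εx * ℓ ≤ ν * ∫ t in (0 : ℝ)..ℓ, gradNormSq (uΓ t) → (∫ t in (0 : ℝ)..ℓ, (∫ x, ‖uΓ t x‖ ^ 2)) ≤ Eb * ℓ → (∀ t, (∫ x, ‖uΓ t x‖ ^ 2) ≤ Pb) → (∀ t, gradNormSq (uΓ t) ≤ Gb) → (εx - 2 * ν * δ * Real.sqrt Gb) * (ℓ / (ℓ + d)) ≤ meanDissipation ν u ∧ meanEnergy u ≤ 2 * Eb + 2 * δ ^ 2 + 2 * Pb * (d / (ℓ + d))) → (∀ S₀ : Finset (Fin 3 → ℤ), ∃ S : Finset (Fin 3 → ℤ), S₀ ⊆ S ∧ ∃ (εx Eb : ℝ), 0 < εx ∧ ∃ U : Set (↥S → ℂ³), IsOpen U ∧ U.Nonempty ∧ ∀ j : ℕ, U ⊆ closure (loopSet S εx Eb j)) → DenseLoudDesignerForces := by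
  intro engine budget physics S₀
  obtain ⟨S, hS, εx, Eb, hεx, U, hU, hUne, hdense⟩ := physics S₀
  refine ⟨S, hS, 2 * Eb + 6, εx / 6, by positivity, U, hU, hUne, fun j => ?_⟩
  exact (hdense j).trans (closure_mono (loopSet_subset_loudSet_of engine budget S Eb hεx j))

/-- **Conditional composition: the three stubs prove the crux `DenseLoudDesignerForces` (by name).**  Hypotheses =
the registered stubs `stub_oneLoopTrains` (ENGINE), `stub_trainBudget` (BUDGET), `stub_denseLoudLoops` (PHYSICS) of
the line `homoclinic-excursion-trains`; when all three have landed the skeleton's `DenseLoudDesignerForces_of` is this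
theorem applied to them. [folklore] -/
theorem DenseLoudDesignerForces_of (engine : (∀ (ν : ℝ) (F : 𝕋³ → ℝ³) (uP : ℝ → 𝕋³ → ℝ³) (τP : ℝ) (uΓ : ℝ → 𝕋³ → ℝ³), 0 < ν → IsHomoclinicLoop ν F uP τP uΓ → ∀ (ℓ : ℝ), 0 ≤ ℓ → ∀ (δ : ℝ), 0 < δ → ∃ d : ℝ, 0 ≤ d ∧ ∃ (u : ℝ → 𝕋³ → ℝ³) (p : ℝ → 𝕋³ → ℝ), IsTrain ν F uΓ ℓ δ d u p))
    (budget : (∀ (ν ℓ δ d εx Eb Pb Gb : ℝ) (F : 𝕋³ → ℝ³) (uΓ u : ℝ → 𝕋³ → ℝ³) (pΓ p : ℝ → 𝕋³ → ℝ), 0 ≤ ν → 0 < ℓ → 0 ≤ d → 0 ≤ δ → IsClassicalNSSolutionOn Set.univ ν (fun _ => F) uΓ pΓ → IsTrain ν F uΓ ℓ δ d u p → εx * ℓ ≤ ν * ∫ t in (0 : ℝ)..ℓ, gradNormSq (uΓ t) → (∫ t in (0 : ℝ)..ℓ, (∫ x, ‖uΓ t x‖ ^ 2)) ≤ Eb *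 ℓ → (∀ t, (∫ x, ‖uΓ t x‖ ^ 2) ≤ Pb) → (∀ t, gradNormSq (uΓ t) ≤ Gb) → (εx - 2 * ν * δ * Real.sqrt Gb) * (ℓ / (ℓ + d)) ≤ meanDissipation ν u ∧ meanEnergy u ≤ 2 * Eb + 2 * δ ^ 2 + 2 * Pb * (d / (ℓ + d))))
    (physics : (∀ S₀ : Finset (Fin 3 → ℤ), ∃ S : Finset (Fin 3 → ℤ), S₀ ⊆ S ∧ ∃ (εx Eb : ℝ), 0 < εx ∧ ∃ U : Set (↥S → ℂ³), IsOpen U ∧ U.Nonempty ∧ ∀ j : ℕ, U ⊆ closure (loopSet S εx Eb j))) :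
    DenseLoudDesignerForces :=
  homoclinic_line_glue engine budget physics

end Summit.AnomalousDissipation.AnomalousDissipation.Theorems.DenseLoudDesignerForces.Homoclinic

end
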